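import Summits.QuantumFields.YangMills.Theorems.BalabanUVNodesN15KingModelHeatKernelTorusDistance
import Literature.MathematicalPhysics.QuantumFieldTheory.King1986.CovarianceQstarDecay
import HarnessLib

/-!
# BalabanUVNodes ∕ N15 — THE KING-MODEL RUNG (PART Ϻ-a): THE PRIMAL WOODBURY FORM OF KING's FULL `A = 0` PROPAGATOR AND ITS ENTRY FORMULA THROUGH BLOCK ROW-SUMS —
# `A₀⁻¹ = G − N^{d+1}·GQᵀΔ_eff QG`, `A₀⁻¹(u,v) = G(u,v) − N^{−(d+1)}Σ_{b,b′}S_u(b)Δ_eff(b,b′)S_v(b′)` with `S_u(b) = Σ_{x∈B(b)}G(u,x) ≥ 0`, `Σ_bS_u(b) = 1∕m²`; the NEAR-ZONE bound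
# `|A₀⁻¹(u,v) − G(u,v)| ≤ N^{−(d+1)}·C_Δ(a,d+1)∕m⁴` at King's scaling `c = N²`, every `N ≥ 1`, every torus, every dimension
# (Track A, DAG node N15 = NE2; FAN-OUT v1.1 §N15 s3 «KING-MODEL RUNG … + what the curved case adds»; count-neutral)

HONEST FRAMING.  Count-neutral (cell `pub-ymgap`, seat `pub-ymgap-dag-n15-e` g56; `--supports stmt-QuantumFields-27247 --as helper` = K3ᴬ, KEY MAP v3).  King's `A = 0` scalar comparison model on the
two-level torus `Tor (fine N M) → Tor M` ([King1986] §2.2, §4): `G = (c(−Δ)+m²)⁻¹ = (lapF (fine N M) c m²)⁻¹` (King's covariance), `A₀ = c(−Δ)+m²+a·Q^*Q = fineOp N M a c m²` (the full one-step fluctuation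
operator (2.13)∕(4.1)–(4.5)), `Δ_eff = a − a²N^{d+1}QA₀⁻¹Qᵀ = effLaplacian N M a c m²` ((2.14)∕(4.5); `Q = Qmat N M` the block mean, King's `η`-adjoint `Q^* = N^{d+1}Qᵀ`).  PART Ϻ (door (t3⁶¹) of the
g55 desk) proves the η-UNIFORM INVERSE-SQUARE LAW for `A₀⁻¹` and for NE2's unit layer `(Δ_eff)⁻¹`; THIS FILE is its algebraic engine:
* §1 ★★ **`fineOp_inv_eq_woodbury`** — THE PRIMAL WOODBURY FORM `A₀⁻¹ = G − N^{d+1}·G·Qᵀ·Δ_eff·Q·G` (`a, c ≥ 0`, `m² > 0`): King's (4.44) `resolvent_444` (`G − A₀⁻¹ = a·G(Q^*Q)A₀⁻¹`) in its mirror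
  form `lapF_inv_sub_fineOp_inv_eq_mirror` (`= a·A₀⁻¹(Q^*Q)G`) composed with the tree's structural identity `lapF_inv_transpose_Qmat_mul_effLaplacian` (`GQᵀΔ_eff = a·A₀⁻¹Qᵀ`) and
  `QᵀQ = N^{−(d+1)}Q^*Q`; the DUAL form `(Δ_eff)⁻¹ = a⁻¹ + N^{d+1}QGQᵀ` is the rung's `effLaplacian_inv_eq_noise_add_blockAvg` (not restated);
* §2 the block row-sums: ★ `mul_transpose_Qmat_apply` (`(BQᵀ)(u,b) = N^{−(d+1)}Σ_{x∈B(b)}B(u,x)`), ★ `Qmat_mul_apply_eq_blockSum`, ★★ `woodbury_sandwich_apply` (`(GQᵀΔQG)(u,v) = N^{−2(d+1)}Σ_{b,b′}S_u(b)Δ(b,b′)S^v(b′)`,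
  `S_u(b) = blockSum (G u ·) b`, `S^v(b′) = blockSum (G · v) b′`), ★★★ **`fineOp_inv_apply_eq`** (`A₀⁻¹(u,v) = G(u,v) − N^{−(d+1)}Σ_{b,b′}S_u(b)Δ_eff(b,b′)S^v(b′)`);
* §3 the row-sums of King's covariance through the blocks: `blockSum_lapF_inv_nonneg` (Ͱ-b `lapF_inv_entry_nonneg`), ★★ `sum_blockSum_lapF_inv_row`∕`_col` (`Σ_bS_u(b) = 1∕m²` — Ϟ-s `sum_lapF_inv_eq_inv_mass` regrouped by
  blocks; the column form by Ν-a `lapF_inv_comm`), `blockSum_lapF_inv_le_inv_mass`;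
* §4 ★ `abs_doubleSum_le_of_abs_le` (`|Σ_{b,b′}S(b)Δ(b,b′)S′(b′)| ≤ K(ΣS)(ΣS′)` for `S, S′ ≥ 0`, `|Δ| ≤ K`), ★★★ **`abs_fineOp_inv_sub_lapF_inv_le_near`** — at King's scaling `c = N²`:
  `|A₀⁻¹(u,v) − G(u,v)| ≤ N^{−(d+1)}·C_Δ(a,d+1)∕m⁴` for ALL `u, v`, every `N ≥ 1`, every torus `M` (King's (4.34)(ii) `|Δ_eff(b,b′)| ≤ C_Δe^{−κ_A·tdist}` = tree `effLaplacian_decay`, constants in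
  `(a,d)` only, with `e^{−…} ≤ 1`); at `d+1 = 4`: `N²|A₀⁻¹ − G| ≤ C_Δ∕(m⁴N²)` — the block correction is TWO powers of `η = 1∕N` below the covariance's own size `N²|G(u,u)| ≍ 1` (Ϯ-e).
WHAT THE CURVED CASE ADDS (one line): the same identity at every unitary `U` with `Q ↦ Q(U)`, `Qᵀ ↦ Q(U)ᴴ`, `G ↦ (−cΔ_U+m²)⁻¹` (Ϥ-k proves the dual form at every `U`; the primal form is the same
algebra) — the row-sum and near-zone bounds then transfer by Kato domination (Ͱ-b) with `n`-dependent constants; not typed here.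
HONEST SCOPE: `A = 0`, periodic b.c., flat block profile, `m² > 0`; identities for every `a, c ≥ 0`; the near bound at `c = N²`, `a > 0`; NOT Bałaban's `G_k(U)` ∕ (3.42); NOT a node discharge
(N15 of record untouched); nothing continuum ∕ ℝ⁴ ∕ OS ∕ mass gap ∕ Clay.
PRIOR TREE ART (by name): King1986.Torus `resolvent_444`, `lapF_inv_transpose_Qmat_mul_effLaplacian`, `transpose_Qmat_mul_Qmat`, `fineOp_isUnit`, `lapF_isUnit`, `effLaplacian_decay`, `CDelta`, `kapA`,
`blockSum`, `blockEquiv`, `site`, `blockOf_site`, `Qmat`, `tdistT_nonneg`; Ϟ-s `sum_lapF_inv_eq_inv_mass`; Ͱ-b `lapF_inv_entry_nonneg`; Ν-a `lapF_inv_comm`.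
Dedup (rg at filing): basename 0 files; needles `fineOp_inv_eq_woodbury|woodbury_sandwich_apply|fineOp_inv_apply_eq|sum_blockSum_lapF_inv|abs_fineOp_inv_sub_lapF_inv_le_near` 0 tree files; `Qmat_mulVec_eq_blockSum`
(PotentialCoherenceTight, `mulVec` form) is the vector twin of §2's matrix-product entries — cited, different statement.  presearch: n/a (finite-dimensional matrix algebra on in-tree objects).
Locators: [King1986] C. King, CMP 102 (1986) 649–677: (2.13)–(2.14) p.653, (4.1)–(4.5) p.670, (4.34) p.674, (4.44)–(4.45) p.675; [Balaban1984PropagatorsI] (1.29) p.23 (the Woodbury pair);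
[Dimock2013] App. D Lemmas 29–30 (the decay constants).  0 `sorry`, 0 `def`.
-/

noncomputable section

open Real Finset Matrix
open scoped BigOperators

namespace Summit.QuantumFields.YangMills.BalabanUVNodes.N15KingModelRung.HeatKernel

open Literature.MathematicalPhysics.QuantumFieldTheory.Balaban1983to89.B5Prop11Plancherel (Tor fine)
open Literature.MathematicalPhysics.QuantumFieldTheory.King1986.Torus
  (lapF Qmat fineOp effLaplacian blockProj blockSum blockEquiv blockEquiv_apply site blockOf blockOf_site tdistT tdistT_nonneg
   resolvent_444 lapF_inv_transpose_Qmat_mul_effLaplacian transpose_Qmat_mul_Qmat fineOp_isUnit lapF_isUnit effLaplacian_decay CDelta kapA kapA_pos CDelta_pos)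
open Summit.QuantumFields.YangMills.BalabanUVNodes.N15KingModelRung.TorusSpectral (sum_lapF_inv_eq_inv_mass lapF_inv_comm)
open Summit.QuantumFields.YangMills.BalabanUVNodes.N15KingModelRung.Covariant (lapF_inv_entry_nonneg)

variable {d : ℕ} (N : ℕ) [NeZero N] (M : Fin (d + 1) → ℕ) [hM : ∀ μ, NeZero (M μ)]

/-! ## §1 The primal Woodbury form `A₀⁻¹ = G − N^{d+1}·GQᵀΔ_eff QG` -/

/-- ★ THE MIRROR OF KING's (4.44): `G − A₀⁻¹ = a·A₀⁻¹(Q^*Q)G` (`A₀⁻¹(A₀ − B)B⁻¹`, `A₀ − B = a·Q^*Q`). [cite: King1986, (4.44) p.675] -/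
theorem lapF_inv_sub_fineOp_inv_eq_mirror {a c m2 : ℝ} (ha : 0 ≤ a) (hc : 0 ≤ c) (hm : 0 < m2) :
    (lapF (fine N M) c m2)⁻¹ - (fineOp N M a c m2)⁻¹ = a • ((fineOp N M a c m2)⁻¹ * blockProj N M * (lapF (fine N M) c m2)⁻¹) := by
  have hA := (Matrix.isUnit_iff_isUnit_det _).mp (fineOp_isUnit N M ha hc hm)
  have hB := (Matrix.isUnit_iff_isUnit_det _).mp (lapF_isUnit N M hc hm)
  have hdiff : fineOp N M a c m2 - lapF (fine N M) c m2 = a • blockProj N M := by rw [fineOp]; abel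
  have h1 : (fineOp N M a c m2)⁻¹ * (fineOp N M a c m2 - lapF (fine N M) c m2) * (lapF (fine N M) c m2)⁻¹
      = (lapF (fine N M) c m2)⁻¹ - (fineOp N M a c m2)⁻¹ := by
    rw [Matrix.mul_sub, Matrix.sub_mul, Matrix.nonsing_inv_mul _ hA, Matrix.one_mul, Matrix.mul_assoc, Matrix.mul_nonsing_inv _ hB, Matrix.mul_one]
  rw [← h1, hdiff, Matrix.mul_smul, Matrix.smul_mul]

/-- ★★ **THE PRIMAL WOODBURY FORM OF KING's FULL PROPAGATOR**: `A₀⁻¹ = G − N^{d+1}·G·Qᵀ·Δ_eff·Q·G` (`G = (c(−Δ)+m²)⁻¹`, `a, c ≥ 0`, `m² > 0`) — from `GQᵀΔ_eff = a·A₀⁻¹Qᵀ`,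
`QᵀQ = N^{−(d+1)}Q^*Q` and the mirror of (4.44). [cite: King1986, (2.13)–(2.14) p.653, (4.44)–(4.45) p.675; Balaban1984PropagatorsI, (1.29) p.23] -/
theorem fineOp_inv_eq_woodbury {a c m2 : ℝ} (ha : 0 ≤ a) (hc : 0 ≤ c) (hm : 0 < m2) :
    (fineOp N M a c m2)⁻¹ = (lapF (fine N M) c m2)⁻¹
      - ((N : ℝ) ^ (d + 1)) • ((lapF (fine N M) c m2)⁻¹ * (Qmat N M)ᵀ * effLaplacian N M a c m2 * Qmat N M * (lapF (fine N M) c m2)⁻¹) := by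
  set B := lapF (fine N M) c m2 with hB
  set A := fineOp N M a c m2 with hA
  have hNd : ((N : ℝ) ^ (d + 1)) ≠ 0 := pow_ne_zero _ (by exact_mod_cast NeZero.ne N)
  have h1 : B⁻¹ * (Qmat N M)ᵀ * effLaplacian N M a c m2 = a • (A⁻¹ * (Qmat N M)ᵀ) := lapF_inv_transpose_Qmat_mul_effLaplacian N M ha hc hm
  have h2 : B⁻¹ * (Qmat N M)ᵀ * effLaplacian N M a c m2 * Qmat N M * B⁻¹ = (a * ((N : ℝ) ^ (d + 1))⁻¹) • (A⁻¹ * blockProj N M * B⁻¹) := by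
    rw [h1, Matrix.smul_mul, Matrix.smul_mul, Matrix.mul_assoc A⁻¹ (Qmat N M)ᵀ (Qmat N M), transpose_Qmat_mul_Qmat, Matrix.mul_smul, Matrix.smul_mul, smul_smul]
  have h3 : ((N : ℝ) ^ (d + 1)) • (B⁻¹ * (Qmat N M)ᵀ * effLaplacian N M a c m2 * Qmat N M * B⁻¹) = B⁻¹ - A⁻¹ := by
    rw [h2, smul_smul, show (N : ℝ) ^ (d + 1) * (a * ((N : ℝ) ^ (d + 1))⁻¹) = a by field_simp, ← lapF_inv_sub_fineOp_inv_eq_mirror N M ha hc hm]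
  rw [h3, sub_sub_cancel]

/-! ## §2 Entries: block row-sums -/

/-- King's block mean on a site of block `b′`: `Q(b, x) = N^{−(d+1)}·[b′ = b]` for `x ∈ B(b′)`. [cite: King1986, (2.4) p.652, (4.1) p.670] -/
theorem Qmat_apply_site (b b' : Tor M) (j : Fin (d + 1) → Fin N) :
    Qmat N M b (site N M b' j) = if b' = b then ((N : ℝ) ^ (d + 1))⁻¹ else 0 := by
  simp only [Qmat, blockOf_site]

/-- ★ `(B·Qᵀ)(u,b) = N^{−(d+1)}·Σ_{x∈B(b)}B(u,x)` — the block ROW-SUM of `B` read by the block mean. [cite: King1986, (4.1) p.670, (4.45) p.675] -/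
theorem mul_transpose_Qmat_apply (B : Matrix (Tor (fine N M)) (Tor (fine N M)) ℝ) (u : Tor (fine N M)) (b : Tor M) :
    (B * (Qmat N M)ᵀ) u b = ((N : ℝ) ^ (d + 1))⁻¹ * blockSum N M (fun x => B u x) b := by
  rw [Matrix.mul_apply, ← (blockEquiv N M).sum_comp, Fintype.sum_prod_type, Finset.sum_eq_single b]
  · simp only [blockEquiv_apply, Matrix.transpose_apply, Qmat_apply_site, if_true, blockSum, Finset.mul_sum]
    exact Finset.sum_congr rfl fun j _ => mul_comm _ _
  · intro b' _ hb'
    simp only [blockEquiv_apply, Matrix.transpose_apply, Qmat_apply_site, if_neg hb', mul_zero, Finset.sum_const_zero]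
  · intro h; exact absurd (Finset.mem_univ b) h

/-- ★ `(Q·B)(b,v) = N^{−(d+1)}·Σ_{x∈B(b)}B(x,v)` — the block COLUMN-SUM. [cite: King1986, (4.1) p.670, (4.45) p.675] -/
theorem Qmat_mul_apply_eq_blockSum (B : Matrix (Tor (fine N M)) (Tor (fine N M)) ℝ) (b : Tor M) (v : Tor (fine N M)) :
    (Qmat N M * B) b v = ((N : ℝ) ^ (d + 1))⁻¹ * blockSum N M (fun x => B x v) b := by
  rw [Matrix.mul_apply, ← (blockEquiv N M).sum_comp, Fintype.sum_prod_type, Finset.sum_eq_single b]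
  · simp only [blockEquiv_apply, Qmat_apply_site, if_true, blockSum, Finset.mul_sum]
  · intro b' _ hb'
    simp only [blockEquiv_apply, Qmat_apply_site, if_neg hb', zero_mul, Finset.sum_const_zero]
  · intro h; exact absurd (Finset.mem_univ b) h

/-- ★★ THE SANDWICH ENTRYWISE: `(B·Qᵀ·Δ·Q·B)(u,v) = N^{−2(d+1)}·Σ_{b,b′}S_u(b)·Δ(b,b′)·S^v(b′)` with the block row-sum `S_u(b) = Σ_{x∈B(b)}B(u,x)` and column-sum `S^v(b′) = Σ_{x∈B(b′)}B(x,v)`.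
[cite: King1986, (4.44)–(4.45) p.675] -/
theorem woodbury_sandwich_apply (B : Matrix (Tor (fine N M)) (Tor (fine N M)) ℝ) (Δ : Matrix (Tor M) (Tor M) ℝ) (u v : Tor (fine N M)) :
    (B * (Qmat N M)ᵀ * Δ * Qmat N M * B) u v
      = (((N : ℝ) ^ (d + 1))⁻¹) ^ 2 * ∑ b, ∑ b', blockSum N M (fun x => B u x) b * Δ b b' * blockSum N M (fun x => B x v) b' := by
  set cN : ℝ := ((N : ℝ) ^ (d + 1))⁻¹ with hcN
  have e : B * (Qmat N M)ᵀ * Δ * Qmat N M * B = (B * (Qmat N M)ᵀ * Δ) * (Qmat N M * B) := by rw [Matrix.mul_assoc]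
  calc (B * (Qmat N M)ᵀ * Δ * Qmat N M * B) u v
      = ∑ b', (∑ b, (cN * blockSum N M (fun x => B u x) b) * Δ b b') * (cN * blockSum N M (fun x => B x v) b') := by
        rw [e, Matrix.mul_apply]
        refine Finset.sum_congr rfl fun b' _ => ?_
        rw [Matrix.mul_apply, Qmat_mul_apply_eq_blockSum]
        exact congrArg₂ (· * ·) (Finset.sum_congr rfl fun b _ => by rw [mul_transpose_Qmat_apply]) rfl
    _ = cN ^ 2 * ∑ b, ∑ b', blockSum N M (fun x => B u x) b * Δ b b' * blockSum N M (fun x => B x v) b' := by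
        rw [Finset.sum_comm, Finset.mul_sum]
        refine Finset.sum_congr rfl fun b' _ => ?_
        rw [Finset.sum_mul, Finset.mul_sum]
        exact Finset.sum_congr rfl fun b _ => by ring

/-- ★★★ **THE ENTRY FORMULA OF KING's FULL PROPAGATOR**: `A₀⁻¹(u,v) = G(u,v) − N^{−(d+1)}·Σ_{b,b′}S_u(b)·Δ_eff(b,b′)·S^v(b′)`, `S_u(b) = Σ_{x∈B(b)}G(u,x)`, `S^v(b′) = Σ_{x∈B(b′)}G(x,v)`
(`a, c ≥ 0`, `m² > 0`). [cite: King1986, (2.13)–(2.14) p.653, (4.44)–(4.45) p.675] -/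
theorem fineOp_inv_apply_eq {a c m2 : ℝ} (ha : 0 ≤ a) (hc : 0 ≤ c) (hm : 0 < m2) (u v : Tor (fine N M)) :
    (fineOp N M a c m2)⁻¹ u v = (lapF (fine N M) c m2)⁻¹ u v
      - ((N : ℝ) ^ (d + 1))⁻¹ * ∑ b, ∑ b', blockSum N M (fun x => (lapF (fine N M) c m2)⁻¹ u x) b * effLaplacian N M a c m2 b b'
          * blockSum N M (fun x => (lapF (fine N M) c m2)⁻¹ x v) b' := by
  have hNd : ((N : ℝ) ^ (d + 1)) ≠ 0 := pow_ne_zero _ (by exact_mod_cast NeZero.ne N)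
  rw [fineOp_inv_eq_woodbury N M ha hc hm, Matrix.sub_apply, Matrix.smul_apply, smul_eq_mul, woodbury_sandwich_apply]
  congr 1
  rw [← mul_assoc]
  congr 1
  field_simp

/-! ## §3 Row-sums of King's covariance through the blocks -/

/-- `S_u(b) = Σ_{x∈B(b)}G(u,x) ≥ 0` (`G ≥ 0` entrywise, Ͱ-b). [cite: King1986, (4.4) p.670; GlimmJaffe1987, §9.? (positivity of `(−Δ+m²)⁻¹`)] -/
theorem blockSum_lapF_inv_nonneg {c m2 : ℝ} (hc : 0 ≤ c) (hm : 0 < m2) (u : Tor (fine N M)) (b : Tor M) :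
    0 ≤ blockSum N M (fun x => (lapF (fine N M) c m2)⁻¹ u x) b :=
  Finset.sum_nonneg fun _ _ => lapF_inv_entry_nonneg (fine N M) hc hm _ _

/-- `S^v(b) = Σ_{x∈B(b)}G(x,v) ≥ 0`. [cite: King1986, (4.4) p.670] -/
theorem blockSum_lapF_inv_col_nonneg {c m2 : ℝ} (hc : 0 ≤ c) (hm : 0 < m2) (v : Tor (fine N M)) (b : Tor M) :
    0 ≤ blockSum N M (fun x => (lapF (fine N M) c m2)⁻¹ x v) b :=
  Finset.sum_nonneg fun _ _ => lapF_inv_entry_nonneg (fine N M) hc hm _ _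

/-- ★★ THE ROW SUM THROUGH THE BLOCKS: `Σ_b S_u(b) = Σ_xG(u,x) = 1∕m²` (Ϟ-s, regrouped by `blockEquiv`). [cite: King1986, (4.4) p.670, (2.16) p.653] -/
theorem sum_blockSum_lapF_inv_row {c m2 : ℝ} (hc : 0 ≤ c) (hm : 0 < m2) (u : Tor (fine N M)) :
    ∑ b, blockSum N M (fun x => (lapF (fine N M) c m2)⁻¹ u x) b = m2⁻¹ := by
  rw [← sum_lapF_inv_eq_inv_mass (fine N M) hc hm u, ← (blockEquiv N M).sum_comp, Fintype.sum_prod_type]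
  simp only [blockEquiv_apply, blockSum]

/-- ★★ THE COLUMN SUM THROUGH THE BLOCKS: `Σ_b S^v(b) = Σ_xG(x,v) = 1∕m²` (symmetry of `G`, Ν-a). [cite: King1986, (4.4) p.670, (2.16) p.653] -/
theorem sum_blockSum_lapF_inv_col {c m2 : ℝ} (hc : 0 ≤ c) (hm : 0 < m2) (v : Tor (fine N M)) :
    ∑ b, blockSum N M (fun x => (lapF (fine N M) c m2)⁻¹ x v) b = m2⁻¹ := by
  have e : (fun x => (lapF (fine N M) c m2)⁻¹ x v) = fun x => (lapF (fine N M) c m2)⁻¹ v x := funext fun x => lapF_inv_comm (fine N M) c m2 x v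
  rw [e]
  exact sum_blockSum_lapF_inv_row N M hc hm v

/-- `S_u(b) ≤ 1∕m²` (one non-negative term of the row sum). [cite: King1986, (4.4) p.670] -/
theorem blockSum_lapF_inv_le_inv_mass {c m2 : ℝ} (hc : 0 ≤ c) (hm : 0 < m2) (u : Tor (fine N M)) (b : Tor M) :
    blockSum N M (fun x => (lapF (fine N M) c m2)⁻¹ u x) b ≤ m2⁻¹ := by
  rw [← sum_blockSum_lapF_inv_row N M hc hm u]
  exact Finset.single_le_sum (fun b' _ => blockSum_lapF_inv_nonneg N M hc hm u b') (Finset.mem_univ b)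

/-- `S^v(b) ≤ 1∕m²`. [cite: King1986, (4.4) p.670] -/
theorem blockSum_lapF_inv_col_le_inv_mass {c m2 : ℝ} (hc : 0 ≤ c) (hm : 0 < m2) (v : Tor (fine N M)) (b : Tor M) :
    blockSum N M (fun x => (lapF (fine N M) c m2)⁻¹ x v) b ≤ m2⁻¹ := by
  rw [← sum_blockSum_lapF_inv_col N M hc hm v]
  exact Finset.single_le_sum (fun b' _ => blockSum_lapF_inv_col_nonneg N M hc hm v b') (Finset.mem_univ b)

/-! ## §4 The near-zone bound: `|A₀⁻¹ − G| ≤ N^{−(d+1)}C_Δ∕m⁴` -/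

/-- ★ A double sum against non-negative weights: `|Σ_{b,b′}S(b)Δ(b,b′)S′(b′)| ≤ K·(Σ_bS(b))·(Σ_{b′}S′(b′))` when `S, S′ ≥ 0` and `|Δ(b,b′)| ≤ K`. [folklore] -/
theorem abs_doubleSum_le_of_abs_le {S S' : Tor M → ℝ} (hS : ∀ b, 0 ≤ S b) (hS' : ∀ b, 0 ≤ S' b) {Δ : Tor M → Tor M → ℝ} {K : ℝ}
    (hΔ : ∀ b b', |Δ b b'| ≤ K) : |∑ b, ∑ b', S b * Δ b b' * S' b'| ≤ K * (∑ b, S b) * (∑ b', S' b') := by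
  calc |∑ b, ∑ b', S b * Δ b b' * S' b'|
      ≤ ∑ b, ∑ b', |S b * Δ b b' * S' b'| := (Finset.abs_sum_le_sum_abs _ _).trans (Finset.sum_le_sum fun b _ => Finset.abs_sum_le_sum_abs _ _)
    _ ≤ ∑ b, ∑ b', S b * K * S' b' := by
        refine Finset.sum_le_sum fun b _ => Finset.sum_le_sum fun b' _ => ?_
        rw [abs_mul, abs_mul, abs_of_nonneg (hS b), abs_of_nonneg (hS' b')]
        exact mul_le_mul_of_nonneg_right (mul_le_mul_of_nonneg_left (hΔ b b') (hS b)) (hS' b')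
    _ = K * (∑ b, S b) * (∑ b', S' b') := by
        rw [mul_assoc, Finset.sum_mul_sum, Finset.mul_sum]
        refine Finset.sum_congr rfl fun b _ => ?_
        rw [Finset.mul_sum]
        exact Finset.sum_congr rfl fun b' _ => by ring

/-- King's (4.34)(ii) without the decay: `|Δ_eff(b,b′)| ≤ C_Δ(a,d+1)` at `c = N²` for ALL `b, b′` (tree `effLaplacian_decay`, `e^{−κ_A·tdist} ≤ 1`). [cite: King1986, (4.34) p.674; Dimock2013, App. D Lemma 30] -/
theorem abs_effLaplacian_le_CDelta {a m2 : ℝ} (ha : 0 < a) (hm : 0 < m2) (b b' : Tor M) :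
    |effLaplacian N M a ((N : ℝ) ^ 2) m2 b b'| ≤ CDelta a (d + 1) := by
  refine (effLaplacian_decay N M ha hm b b').trans ?_
  have h1 : Real.exp (-(kapA a (d + 1) * tdistT M b b')) ≤ 1 := by
    rw [Real.exp_le_one_iff, neg_nonpos]
    exact mul_nonneg (kapA_pos ha (d + 1)).le (tdistT_nonneg M b b')
  calc CDelta a (d + 1) * Real.exp (-(kapA a (d + 1) * tdistT M b b')) ≤ CDelta a (d + 1) * 1 :=
        mul_le_mul_of_nonneg_left h1 (CDelta_pos ha (d + 1)).le
    _ = CDelta a (d + 1) := mul_one _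

/-- ★★★ **THE NEAR-ZONE BOUND** (King's scaling `c = N²`, `a, m² > 0`, every `N ≥ 1`, every torus, ALL `u, v`): `|A₀⁻¹(u,v) − G(u,v)| ≤ N^{−(d+1)}·C_Δ(a,d+1)∕m⁴` — the block correction of the
full propagator is uniformly `O(η^{d+1})`; in `d+1 = 4`, `N²|A₀⁻¹(u,v) − G(u,v)| ≤ C_Δ∕(m⁴N²)`. [cite: King1986, (2.13)–(2.14) p.653, (4.34) p.674, (4.44)–(4.45) p.675; Dimock2013, App. D Lemma 30] -/
theorem abs_fineOp_inv_sub_lapF_inv_le_near {a m2 : ℝ} (ha : 0 < a) (hm : 0 < m2) (u v : Tor (fine N M)) :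
    |(fineOp N M a ((N : ℝ) ^ 2) m2)⁻¹ u v - (lapF (fine N M) ((N : ℝ) ^ 2) m2)⁻¹ u v| ≤ ((N : ℝ) ^ (d + 1))⁻¹ * (CDelta a (d + 1) / m2 ^ 2) := by
  have hc : (0 : ℝ) ≤ (N : ℝ) ^ 2 := by positivity
  have hNd : 0 < ((N : ℝ) ^ (d + 1)) := pow_pos (by exact_mod_cast Nat.pos_of_ne_zero (NeZero.ne N)) _
  rw [fineOp_inv_apply_eq N M ha.le hc hm u v, sub_sub_cancel_left, abs_neg, abs_mul, abs_of_pos (inv_pos.mpr hNd)]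
  refine mul_le_mul_of_nonneg_left ?_ (inv_pos.mpr hNd).le
  refine (abs_doubleSum_le_of_abs_le M (blockSum_lapF_inv_nonneg N M hc hm u) (blockSum_lapF_inv_col_nonneg N M hc hm v)
    (abs_effLaplacian_le_CDelta N M ha hm)).trans (le_of_eq ?_)
  rw [sum_blockSum_lapF_inv_row N M hc hm u, sum_blockSum_lapF_inv_col N M hc hm v]
  field_simp

end Summit.QuantumFields.YangMills.BalabanUVNodes.N15KingModelRung.HeatKernel

end
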